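import Literature.MathematicalPhysics.QuantumFieldTheory.Balaban1983to89.TreeLengthTorusGeometry
import Summits.QuantumFields.BalabanUV.T4Continuum.Spine.NE1p.DressedSmallFieldInduction

/-!
# T⁴ programme, spine estimate NE1′ (node O3b/H2) — THE SMALL-FIELD PENCIL FACES OVER A PROVED POLYMER GEOMETRY: the geometry
# binder group (B4) (footprint locality, (1.26), (2.30), (2.27)) FED from a `B13Resummation.Geometry`, and DISCHARGED BY NAME on
# Bałaban's periodic carrier by the tree's torus geometry `tgeometry 4 N` (unit pv22) — after this file the small-field half of
# PAY ∕ (w5) displays only (E1)∕(E2) per polymer, the (2.38)-majorant at the dressed constant, the two clauses and the window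

Cell `pub-balaban`, sub-cell `t4`, BINDER-OWNERS row NE1′; owner lineage t4-ne1p-p1 (PROVER seat P1, «RG-trajectory comparison
…»), generation 26; ADDITIVE — imports `Literature/…/Balaban1983to89/TreeLengthTorusGeometry` (unit pv22: the polymer geometry
of 𝐃_{k+1} CONSTRUCTED on the torus with all fields PROVED; [cite]-tagged) and N0m `Spine/NE1p/DressedSmallFieldInduction`
(p220799) ONLY; THEOREMS ONLY.

WHY THIS FILE.  The small-field ENDs of N0j ∕ N0m display five GEOMETRY binders — `hloc`, `hreach`, `h126 : Ineq126 univ …`,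
`hvol : VolBound univ …`, `h227 : Ineq227 univ …` — «the tree's `B13FamilySum` shapes, instantiated on Bałaban's d_k by nobody
yet» (N0j's docstring; (B4) of the wall refinement adopted as v1.6-proposed, T4-DAG v35 Q44 (b)).  That sentence was true for
`Finset.univ` of an abstract `Dom` but the TREE ALREADY HOLDS the instance: `B13Resummation.Geometry D Cube` (unit pv18)
packages exactly these binders (+ nonnegativity, + (2.27) with print's constant 5 at every footprint) over a localization-domain
system `D : LocDomainSys`, and `TreeLengthTorusGeometry.tgeometry d N` (unit pv22) CONSTRUCTS it on the periodic carrier of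
[Balaban1987RG1] p. 251 («a torus T obtained by the usual identification of boundary points of the cube …») with the
incompatibility `TTouch` = the ζ of [Balaban1988RG2Cluster] (2.11) p. 14 and ALL fields PROVED ((1.26) at κ₀ = κ₀(4·2^d, 2d),
(2.30) at c₁ = 4·2^d, (2.27) with the printed 5, reach with ν = 2d + 1; for d = 4: ν = 9, κ₀ = 64·log 162, c₁ = 64 —
`tgeometry_consts_four`).  So (B4) is not a binder of the cell at all: it is DISCHARGED in the tree.  THIS FILE wires it:
* §1 over any `G : Geometry D Cube`: `muPart_locE_le_geom` (N0j `muPart_locE_le`), `norm_locE_le_geom`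
  (`norm_locE_le_of_majorant`), `differentiableOn_locE_geom` (`differentiableOn_locE_of_majorant`), `attachedPart_locE_le_geom`
  (N0m `attachedPart_locE_le`) — each BY NAME with `hloc` ∕ `hreach` ∕ `h126` ∕ `hvol` ∕ `h227` ∕ nonnegativity FED from `G`'s
  fields (`open Classical` for decidability and `Std.Refl`∕`Std.Symm` from `G.ι_refl`∕`G.ι_symm`, exactly as
  `B13Resummation.cammarotaStepWith_of_KP` does); localization set = the footprint `G.cubes X₀` of a domain `X₀`, `dX = d(X₀)`,
  (2.27)-constant 5 (so `hb : 5·r₁ ≤ b`).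
* §2 on the torus: `muPart_locE_le_torus` = §1 at `D := tsys 4 N`, `G := tgeometry 4 N` — the μ-part of the dressed small-field
  output on a scale-(k+1) domain `X₀` of the four-torus of `N⁴` cubes is `≤ e·ν·c₁·K₀²·A·e^{−r₁ d_{k+1}(X₀)}·μ₀/(μ₁ − μ₀)`
  modulo ONLY: (E1)∕(E2) per polymer (`hhol`∕`hm` — ⇐ N0k ∕ N0l: the (2.14)-shape READING (B1) + births ∕ sizes ∕ window), the
  (2.38)-majorant at the dressed constant (`hL3` = (B3) = G-ne9p2-5), the clauses «κ large» `r₁ + 2·64·log 162 + 2 ≤ R` and «ε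
  small» `A·e^{b+1}·K₀(64,8)·9·64 ≤ 1` ((B5), arithmetic on print-type constants) and the source window; `torus_consts` records
  ν, κ₀, c₁ BY NAME.
WHAT THIS DOES TO THE WALL TEXT (owner's reading; the dagwriter books): in the v1.6-proposed small-field bracket «(B1) ∧ (B2) ∧
(B3) ∧ (B4) ∧ (B5)», (B2) was discharged by N0l into (w1) + L-B + (w6) + the «Lemma 1» map's bound, and (B4) is hereby
discharged BY NAME on the torus catalogue (pv22) — leaving (B1) [READING] ∧ (B3) [= G-ne9p2-5, shared with NE9] ∧ (B5)
[arithmetic] for the small-field half.  NOT CLAIMED: that the dressed run's localization domains ARE `tsys 4 N`'s (the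
identification of Bałaban's 𝐃_{k+1} with the torus system is pv22's READING of p. 251 ∕ p. 257, recorded in that module —
DIVERGENCE D-pv22.3 ∕ D-pv22g2.1); anything at met steps; NE1′.

HONEST FRAMING.  By-name kernel wiring over SHAPES + the tree's PROVED torus geometry; nothing of Bałaban's densities
instantiated; loci TYPE∕CONTEXT ([Balaban1987RG1] p. 251, [Balaban1988RG2Cluster] (2.11) p. 14, (1.26) p. 8, (2.27)∕(2.30) p. 18
— quoted with [cite] tags in `TreeLengthTorusGeometry` ∕ `B13FamilySum`, not re-asserted here); ABSOLUTE RULE honoured.  NE1′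
NOT printed, NOT proved; spine PROVED 0∕9; count 9 unchanged.  Rung (B)+1 on ONE finite four-torus — NOT infinite volume, NOT a
mass gap, NOT OS on ℝ⁴, NOT Clay.  HONEST DEPENDENCY: continuum YM on T⁴ ⇐ BetaPertH ∧ nine spine estimates (0/9 proved);
BetaPertH ⇐ (D1) ∧ (D4) ∧ CAP+tail; G-an2-4 gates asym, D1 and NE2/3/4.
-/

noncomputable section

namespace Summit.QuantumFields.BalabanUV.T4Continuum.NE1p.DressedSmallFieldGeometry

open Metric Set Complex
open scoped BigOperators
open Literature.MathematicalPhysics.QuantumFieldTheory.Balaban1983to89 (LocDomainSys)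
open Literature.MathematicalPhysics.QuantumFieldTheory.Balaban1983to89.B13Resummation (locE Geometry)
open Literature.MathematicalPhysics.QuantumFieldTheory.Balaban1983to89.TreeLengthTorus (TPt TDom tsys)
open Literature.MathematicalPhysics.QuantumFieldTheory.Balaban1983to89.TreeLengthTorusGeometry (tgeometry TTouch)
open Summit.QuantumFields.BalabanUV.T4Continuum.NE1p.DressedSmallFieldPencil (muPart_locE_le norm_locE_le_of_majorant
  differentiableOn_locE_of_majorant)
open Summit.QuantumFields.BalabanUV.T4Continuum.NE1p.DressedSmallFieldInduction (attachedPart_locE_le)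

/-! ## §1 THE PENCIL FACES OVER A PROVED POLYMER GEOMETRY `B13Resummation.Geometry` — the binder group (B4) FED -/

section OverGeometry

variable (D : LocDomainSys) {Cube : Type} [DecidableEq Cube] (G : Geometry D Cube)

open Classical in
/-- **THE μ-PART OVER A GEOMETRY** (kernel; `DressedSmallFieldPencil.muPart_locE_le` BY NAME with the geometry binders `hloc` ∕
`hreach` ∕ (1.26) ∕ (2.30) ∕ (2.27) and the nonnegativity of the constants FED from the fields of a `B13Resummation.Geometry G`
of a localization-domain system `D`; the localization set is the footprint `G.cubes X₀` of a domain `X₀`, `dX = d(X₀)`, the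
(2.27) constant is print's `5`).  Remaining binders: (E1)∕(E2) `hhol`∕`hm`, the (2.38)-shape majorant `hL3` (= (B3)), the
clauses `hrate : r₁ + 2κ₀ + 2 ≤ R`, `hsmall : A·e^{b+1}·K₀·ν·c₁ ≤ 1` with `5r₁ ≤ b`, the source window. -/
theorem muPart_locE_le_geom {m : D.Dom → ℝ} {act : ℂ → D.Dom → ℂ} {A R r₁ b μ₁ μ₀ : ℝ} {X₀ : D.Dom} {μ : ℂ}
    (hA : 0 ≤ A) (hr₁ : 0 ≤ r₁) (hb : r₁ * 5 ≤ b) (hrate : r₁ + 2 * G.κ₀ + 2 ≤ R)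
    (hsmall : A * Real.exp (b + 1) * G.K₀ * G.ν * G.c₁ ≤ 1)
    (hhol : ∀ Z, G.cubes Z ⊆ G.cubes X₀ → DifferentiableOn ℂ (fun s => act s Z) (ball (0 : ℂ) μ₁))
    (hm : ∀ s ∈ ball (0 : ℂ) μ₁, ∀ Z, G.cubes Z ⊆ G.cubes X₀ → ‖act s Z‖ ≤ m Z)
    (hL3 : ∀ Z, G.cubes Z ⊆ G.cubes X₀ → m Z ≤ A * Real.exp (-(R * D.dj Z)))
    (h0 : 0 < μ₀) (h01 : μ₀ < μ₁) (hμ : ‖μ‖ ≤ μ₀) :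
    ‖locE G.ι G.cubes (act μ) (G.cubes X₀) - locE G.ι G.cubes (act 0) (G.cubes X₀)‖ ≤
      Real.exp 1 * G.ν * G.c₁ * G.K₀ ^ 2 * A * Real.exp (-(r₁ * D.dj X₀)) * (μ₀ / (μ₁ - μ₀)) := by
  haveI : Std.Refl G.ι := ⟨G.ι_refl⟩
  haveI : Std.Symm G.ι := ⟨G.ι_symm⟩
  exact muPart_locE_le G.ι G.loc G.reach_le D.dj_nonneg hA G.K₀_nonneg G.c₁_nonneg G.ν_nonneg G.κ₀_nonneg hr₁
    (by norm_num) hb G.ineq126 G.volBound (G.ineq227 X₀) hrate hsmall (G.cubes_nonempty X₀) hhol hm hL3 h0 h01 hμ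

open Classical in
/-- **THE μ-UNIFORM (2.41) ENVELOPE OVER A GEOMETRY** (`norm_locE_le_of_majorant` BY NAME, geometry FED). -/
theorem norm_locE_le_geom {m : D.Dom → ℝ} {act : ℂ → D.Dom → ℂ} {A R r₁ b μ₁ : ℝ} {X₀ : D.Dom}
    (hA : 0 ≤ A) (hr₁ : 0 ≤ r₁) (hb : r₁ * 5 ≤ b) (hrate : r₁ + 2 * G.κ₀ + 2 ≤ R)
    (hsmall : A * Real.exp (b + 1) * G.K₀ * G.ν * G.c₁ ≤ 1)
    (hm : ∀ s ∈ ball (0 : ℂ) μ₁, ∀ Z, G.cubes Z ⊆ G.cubes X₀ → ‖act s Z‖ ≤ m Z)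
    (hL3 : ∀ Z, G.cubes Z ⊆ G.cubes X₀ → m Z ≤ A * Real.exp (-(R * D.dj Z))) {s : ℂ} (hs : s ∈ ball (0 : ℂ) μ₁) :
    ‖locE G.ι G.cubes (act s) (G.cubes X₀)‖ ≤ Real.exp 1 * G.ν * G.c₁ * G.K₀ ^ 2 * A * Real.exp (-(r₁ * D.dj X₀)) := by
  haveI : Std.Refl G.ι := ⟨G.ι_refl⟩
  haveI : Std.Symm G.ι := ⟨G.ι_symm⟩
  exact norm_locE_le_of_majorant G.ι G.loc G.reach_le D.dj_nonneg hA G.K₀_nonneg G.c₁_nonneg G.ν_nonneg G.κ₀_nonneg hr₁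
    (by norm_num) hb G.ineq126 G.volBound (G.ineq227 X₀) hrate hsmall (G.cubes_nonempty X₀) hm hL3 hs

open Classical in
/-- **HOLOMORPHY IN THE SOURCE OVER A GEOMETRY** (`differentiableOn_locE_of_majorant` BY NAME, geometry FED). -/
theorem differentiableOn_locE_geom {m : D.Dom → ℝ} {act : ℂ → D.Dom → ℂ} {A R r₁ b μ₁ : ℝ} {X₀ : D.Dom}
    (hA : 0 ≤ A) (hr₁ : 0 ≤ r₁) (hb : r₁ * 5 ≤ b) (hrate : r₁ + 2 * G.κ₀ + 2 ≤ R)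
    (hsmall : A * Real.exp (b + 1) * G.K₀ * G.ν * G.c₁ ≤ 1)
    (hhol : ∀ Z, G.cubes Z ⊆ G.cubes X₀ → DifferentiableOn ℂ (fun s => act s Z) (ball (0 : ℂ) μ₁))
    (hm : ∀ s ∈ ball (0 : ℂ) μ₁, ∀ Z, G.cubes Z ⊆ G.cubes X₀ → ‖act s Z‖ ≤ m Z)
    (hL3 : ∀ Z, G.cubes Z ⊆ G.cubes X₀ → m Z ≤ A * Real.exp (-(R * D.dj Z))) :
    DifferentiableOn ℂ (fun s => locE G.ι G.cubes (act s) (G.cubes X₀)) (ball (0 : ℂ) μ₁) := by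
  haveI : Std.Refl G.ι := ⟨G.ι_refl⟩
  haveI : Std.Symm G.ι := ⟨G.ι_symm⟩
  exact differentiableOn_locE_of_majorant G.ι G.loc G.reach_le D.dj_nonneg hA G.K₀_nonneg G.ν_nonneg G.κ₀_nonneg hr₁
    (by norm_num) hb G.ineq126 G.volBound hrate hsmall hhol hm hL3

open Classical in
/-- **THE INDUCTION FACE OVER A GEOMETRY** (`DressedSmallFieldInduction.attachedPart_locE_le` BY NAME, geometry FED): the attached
part along the TABLE-STRENGTH pencil is `≤ 4·(e ν c₁ K₀²)·A₁·e^{−r₁ d(X₀)}`, LINEAR in the slope of the affine (2.38)-majorant. -/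
theorem attachedPart_locE_le_geom {m : D.Dom → ℝ} {act : ℂ → D.Dom → ℂ} {A₀ A₁ R r₁ b ϱ : ℝ} {X₀ : D.Dom}
    (hA₀ : 0 ≤ A₀) (hA₁ : 0 ≤ A₁) (hr₁ : 0 ≤ r₁) (hb : r₁ * 5 ≤ b) (hrate : r₁ + 2 * G.κ₀ + 2 ≤ R)
    (hsmall : (A₀ + ϱ * A₁) * Real.exp (b + 1) * G.K₀ * G.ν * G.c₁ ≤ 1)
    (hhol : ∀ Z, G.cubes Z ⊆ G.cubes X₀ → DifferentiableOn ℂ (fun s => act s Z) (ball (0 : ℂ) ϱ))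
    (hm : ∀ s ∈ ball (0 : ℂ) ϱ, ∀ Z, G.cubes Z ⊆ G.cubes X₀ → ‖act s Z‖ ≤ m Z)
    (hL3 : ∀ Z, G.cubes Z ⊆ G.cubes X₀ → m Z ≤ (A₀ + ϱ * A₁) * Real.exp (-(R * D.dj Z))) (hϱ : 2 ≤ ϱ)
    (hϱA : A₀ ≤ ϱ * A₁) :
    ‖locE G.ι G.cubes (act 1) (G.cubes X₀) - locE G.ι G.cubes (act 0) (G.cubes X₀)‖ ≤
      4 * (Real.exp 1 * G.ν * G.c₁ * G.K₀ ^ 2) * A₁ * Real.exp (-(r₁ * D.dj X₀)) := by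
  haveI : Std.Refl G.ι := ⟨G.ι_refl⟩
  haveI : Std.Symm G.ι := ⟨G.ι_symm⟩
  exact attachedPart_locE_le G.ι G.loc G.reach_le D.dj_nonneg hA₀ hA₁ G.K₀_nonneg G.c₁_nonneg G.ν_nonneg G.κ₀_nonneg hr₁
    (by norm_num) hb G.ineq126 G.volBound (G.ineq227 X₀) hrate hsmall (G.cubes_nonempty X₀) hhol hm hL3 hϱ hϱA

end OverGeometry

/-! ## §2 ON BAŁABAN'S PERIODIC CARRIER: the torus geometry `tgeometry 4 N` of 𝐃_{k+1} (unit pv22, all fields PROVED) — the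
geometry group (B4) of the small-field half DISCHARGED BY NAME, with the printed-type constants ν = 9, κ₀ = 64·log 162,
K₀ = K₀(64, 8), c₁ = 64, c = 5 -/

section Torus

variable (N : ℕ) [NeZero N]

open Classical in
/-- **THE μ-PART OF THE DRESSED SMALL-FIELD OUTPUT ON THE FOUR-TORUS CATALOGUE** (kernel; §1 at `G := tgeometry 4 N`,
`D := tsys 4 N` — the tree's construction of the polymer geometry of 𝐃_{k+1} on the periodic carrier of [Balaban1987RG1] p. 251
with (1.26) ∕ (2.27) ∕ (2.30) ∕ footprint locality PROVED there, incompatibility `TTouch` = the ζ of (2.11) p. 14): for a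
scale-(k+1) domain `X₀` of the torus of `N⁴` cubes, the observable-attached part of `E(X₀)` is
`≤ e·9·64·K₀(64,8)²·A·e^{−r₁ d_{k+1}(X₀)}·μ₀/(μ₁ − μ₀)` — modulo ONLY (E1)∕(E2) per polymer (`hhol`∕`hm`), the (2.38)-majorant
at the dressed constant (`hL3` = (B3) = G-ne9p2-5), the clauses («κ large»: `r₁ + 2·64·log 162 + 2 ≤ R`; «ε small»:
`A·e^{b+1}·K₀(64,8)·9·64 ≤ 1`, `5r₁ ≤ b`) and the window.  NO geometry binder remains. -/
theorem muPart_locE_le_torus {m : (tsys 4 N).Dom → ℝ} {act : ℂ → (tsys 4 N).Dom → ℂ} {A R r₁ b μ₁ μ₀ : ℝ}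
    {X₀ : (tsys 4 N).Dom} {μ : ℂ}
    (hA : 0 ≤ A) (hr₁ : 0 ≤ r₁) (hb : r₁ * 5 ≤ b) (hrate : r₁ + 2 * (tgeometry 4 N).κ₀ + 2 ≤ R)
    (hsmall : A * Real.exp (b + 1) * (tgeometry 4 N).K₀ * (tgeometry 4 N).ν * (tgeometry 4 N).c₁ ≤ 1)
    (hhol : ∀ Z : (tsys 4 N).Dom, Z.1 ⊆ X₀.1 → DifferentiableOn ℂ (fun s => act s Z) (ball (0 : ℂ) μ₁))
    (hm : ∀ s ∈ ball (0 : ℂ) μ₁, ∀ Z : (tsys 4 N).Dom, Z.1 ⊆ X₀.1 → ‖act s Z‖ ≤ m Z)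
    (hL3 : ∀ Z : (tsys 4 N).Dom, Z.1 ⊆ X₀.1 → m Z ≤ A * Real.exp (-(R * (tsys 4 N).dj Z)))
    (h0 : 0 < μ₀) (h01 : μ₀ < μ₁) (hμ : ‖μ‖ ≤ μ₀) :
    ‖locE (TTouch (d := 4) (N := N)) (fun Z : (tsys 4 N).Dom => Z.1) (act μ) X₀.1 -
        locE (TTouch (d := 4) (N := N)) (fun Z : (tsys 4 N).Dom => Z.1) (act 0) X₀.1‖ ≤
      Real.exp 1 * (tgeometry 4 N).ν * (tgeometry 4 N).c₁ * (tgeometry 4 N).K₀ ^ 2 * A *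
        Real.exp (-(r₁ * (tsys 4 N).dj X₀)) * (μ₀ / (μ₁ - μ₀)) :=
  muPart_locE_le_geom (tsys 4 N) (tgeometry 4 N) hA hr₁ hb hrate hsmall hhol hm hL3 h0 h01 hμ

/-- The torus constants entering the two clauses and the envelope, BY NAME (`tgeometry_consts_four`): ν = 9, κ₀ = 64·log 162,
c₁ = 64 (and K₀ = `B12TreeDecay.K₀ 64 8`). [folklore] -/
theorem torus_consts : (tgeometry 4 N).ν = 9 ∧ (tgeometry 4 N).κ₀ = 64 * Real.log 162 ∧ (tgeometry 4 N).c₁ = 64 :=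
  Literature.MathematicalPhysics.QuantumFieldTheory.Balaban1983to89.TreeLengthTorusGeometry.tgeometry_consts_four N

end Torus

end Summit.QuantumFields.BalabanUV.T4Continuum.NE1p.DressedSmallFieldGeometry

end
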